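import Summits.QuantumFields.YangMills.Theorems.SteinGapBootstrapFreeProbeLawGStubSdRateCore
import Summits.QuantumFields.YangMills.Theorems.EquipartitionCriticalityEquipartitionPinsProbeTangentSteinDefect
import HarnessLib

/-!
# Crux U `FreeProbeLawG` (stmt-QuantumFields-23756), line `birth`, STUB `stub_sdRate` — part 2: the single-edge defect for
# `C¹` block tests of the rescaled plaquette field of a torus-limit state

Route `SteinGapBootstrap` of `QuantumFields/YangMills` (width seat `ym-line-sgb-p1-w2`; helper for the registered stub `stub_sdRate`
of the lead's skeleton `Cruxes/FreeProbeLawG/Lines/birth.lean`). HONEST LABEL: the route serves the RECORD-label rung R2ξ-G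
(`WeakCouplingRates.XiPow`, an UPPER bound on the lattice gap); nothing here bears on the Yang–Mills mass gap itself.

`SdRate.defect_fderiv_le`: for a link `e`, a colour `b` with one-parameter subgroup `ρ(k_t) = exp(t e_b)`, the derivative statements
of the tree's STUBS TS3/TS4 (`stub_shiftDerivField` + TS0 `stub_combShift`, `stub_shiftDerivAction`; hypotheses `h3`, `h4` with
constants `K₃, K₄ ≤ K`), every `β > 0`, every torus-limit state `μ ∈ infiniteVolumeLimitPoints r.ρ β`, every
`S ⊇ plaquettesTouching {e}`, every `C¹` test `g` of the block `Y_S` with `|g| ≤ 1`, `‖∇g‖ ≤ M`, and every `θ > 0`: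

  `|∑_{p∈S} (dδ_e)_p ∫ ∂_{(p,b)} g(Y_S) dμ − ∫ g(Y_S) ∑_{p∈S} (dδ_e)_p Y_p^b dμ| ≤ M (θ/2 + K ∫ ∑_{p∈S} W_p dμ/(2θ)) + K√β ∫ ∑_{q∈Pe} W_q dμ`,

`W_p = ∑_i (N − Re tr ρ(Ũ_{∂_i p}))` the comb-gauge link energies of the boundary of `p`. This is the tree's
`TangentSteinFiniteBeta.defect_le` (crux 8760) with the trigonometric core replaced by `SdRate.core_defect_fderiv` (part 1): the LEFT
shift family for non-comb links and forward comb links, the RIGHT family for backward comb links (`leftFamily`/`rightFamily`,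
flow property from `stub_combShift`), and the skew Haar-shift identity of limit states `stub_haarShiftLimit` for the continuous
bounded cylinder observable `U ↦ g(Y_S(U))` (`cylinder_block`). `defect_fderiv_le'` discharges `h3`/`h4` by the tree stubs.
Adapted from `Theorems/EquipartitionCriticalityEquipartitionPinsProbeTangentSteinDefect.lean`.

Reference: S. Chatterjee, arXiv:1602.01222 §§9–11. [arXiv160201222]
-/

set_option autoImplicit false

noncomputable section

open MeasureTheory Filter Topology
open scoped Matrix Matrix.Norms.Frobenius
open Literature.Probability.LatticeModels Literature.MathematicalPhysics.QuantumLattice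
open Literature.MathematicalPhysics.QuantumFieldTheory hiding ZdEdge IsLocalObservable IsInfiniteVolumeLimit
open Summit.QuantumFields.YangMills.Theorems.EquipartitionPinsProbe
open Summit.QuantumFields.YangMills.Theorems.EquipartitionPinsProbe.TangentSteinFiniteBeta

namespace Summit.QuantumFields.YangMills.Cruxes.FreeProbeLawG.SteinFree

namespace SdRate

section Cylinder

variable {G : Type} [Group G] [TopologicalSpace G] [IsTopologicalGroup G]

/-- The block test observable `U ↦ g(Y_S(U))`, `Y_S(U) = (Y_p^a(U))_{p ∈ S, a}`, is a continuous cylinder observable bounded by `1`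
(for continuous `g` with `|g| ≤ 1`; each coordinate `Y_p^a` is a continuous cylinder observable, tree `isCylinder_plaqField`). -/
theorem cylinder_block (r : LatticeRep G) (β : ℝ) (S : Finset (ZdPlaquette 4))
    (g : (↥S → Fin (lieDim r) → ℝ) → ℝ) (hgc : Continuous g) (hgb : ∀ y, |g y| ≤ 1) :
    ∃ SF : Finset (Literature.MathematicalPhysics.QuantumLattice.ZdEdge 4),
      IsCylinder (fun U : LGConfig 4 G => g (fun q a => plaqField r β U q a)) SF ∧
      Continuous (fun U : LGConfig 4 G => g (fun q a => plaqField r β U q a)) ∧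
      ∀ U : LGConfig 4 G, |g (fun q a => plaqField r β U q a)| ≤ 1 := by
  classical
  refine ⟨S.biUnion fun p => (Fintype.piFinset fun _ : Fin 4 => Finset.Icc (-(2 + ∑ i, |p.1 i|)) (2 + ∑ i, |p.1 i|)) ×ˢ
    Finset.univ, ?_, ?_, fun U => hgb _⟩
  · intro U U' hUU'
    refine congrArg g (funext fun q => funext fun a => ?_)
    have hc := TangentPlaqFieldContinuous.isCylinder_plaqField r β (q : ZdPlaquette 4) a (2 + ∑ i, |q.1.1 i|)
      (TangentPlaqFieldContinuous.abs_add_two_le_sum q.1.1) (fun e he => hUU' e (Finset.mem_biUnion.2 ⟨q, q.2, he⟩))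
    dsimp only at hc
    exact hc
  · exact hgc.comp (continuous_pi fun q => continuous_pi fun a =>
      TangentPlaqFieldContinuous.continuous_plaqField_apply r β (q : ZdPlaquette 4) a)

end Cylinder

section Pair

variable {G : Type} [Group G] [TopologicalSpace G] [IsTopologicalGroup G] [CompactSpace G]
  [MeasurableSpace G] [BorelSpace G] [SecondCountableTopology G]

/-- **The `C¹` block defect for a concrete shift family.** For a one-link shift flow `T` of the link `e` with sign `σ`, satisfying
the derivative statements for the plaquette field and the boundary action and the skew Haar-shift identity for every bounded
continuous cylinder observable: `core_defect_fderiv` applied to `g ∘ Y_S`. -/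
theorem defect_fderiv_pair (r : LatticeRep G) {β : ℝ} (hβ : 0 < β) (μ : Measure (LGConfig 4 G)) [IsProbabilityMeasure μ]
    (e : Literature.MathematicalPhysics.QuantumLattice.ZdEdge 4) (b : Fin (lieDim r)) (S : Finset (ZdPlaquette 4))
    (hS : plaquettesTouching ({e} : Finset (Literature.MathematicalPhysics.QuantumLattice.ZdEdge 4)) ⊆ S)
    (σ : ℝ) (hσ : σ = 1 ∨ σ = -1)
    (T : ℝ → LGConfig 4 G → LGConfig 4 G) (hT0 : ∀ U, T 0 U = U) (hflow : ∀ s t U, T (t + s) U = T t (T s U))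
    (hTc : Continuous fun q : ℝ × LGConfig 4 G => T q.1 q.2) (K : ℝ) (hK : 0 ≤ K)
    (hY : ∀ (U : LGConfig 4 G) (p : ZdPlaquette 4) (a : Fin (lieDim r)), ∃ err : ℝ,
      HasDerivAt (fun t => plaqField r β (T t U) p a)
        (Real.sqrt β * (σ * (if a = b then plaquetteCurl (fun e' => if e' = e then (1 : ℝ) else 0) p else 0) + err)) 0 ∧
      err ^ 2 ≤ K * ∑ i : Fin 4, ((r.N : ℝ) - (r.ρ (axialFix U (plaquetteBoundary p i))).trace.re))
    (hD : ∀ U : LGConfig 4 G, ∃ D : ℝ, HasDerivAt (fun t => wilsonBoundaryAction r.ρ {e} (T t U)) D 0 ∧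
      |Real.sqrt β * D - σ * ∑ q ∈ plaquettesTouching ({e} : Finset (Literature.MathematicalPhysics.QuantumLattice.ZdEdge 4)),
          plaquetteCurl (fun e' => if e' = e then (1 : ℝ) else 0) q * plaqField r β U q b| ≤
        K * Real.sqrt β * ∑ q ∈ plaquettesTouching ({e} : Finset (Literature.MathematicalPhysics.QuantumLattice.ZdEdge 4)),
          ∑ i : Fin 4, ((r.N : ℝ) - (r.ρ (axialFix U (plaquetteBoundary q i))).trace.re))
    (hHaar : ∀ (F : LGConfig 4 G → ℝ) (SF : Finset (Literature.MathematicalPhysics.QuantumLattice.ZdEdge 4)),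
      IsCylinder F SF → Continuous F → (∃ C : ℝ, ∀ U, |F U| ≤ C) →
      ∀ t : ℝ, ∫ U, F (T t U) ∂μ =
        ∫ U, F U * Real.exp (-(β * (wilsonBoundaryAction r.ρ {e} (T (-t) U) - wilsonBoundaryAction r.ρ {e} U))) ∂μ)
    (g : (↥S → Fin (lieDim r) → ℝ) → ℝ) {M : ℝ} (hM : 0 ≤ M) (hg : ContDiff ℝ 1 g)
    (hgb : ∀ y, |g y| ≤ 1) (hgM : ∀ y, ‖fderiv ℝ g y‖ ≤ M) {θ : ℝ} (hθ : 0 < θ) :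
    |(∑ p : ↥S, plaquetteCurl (fun e' => if e' = e then (1 : ℝ) else 0) (p : ZdPlaquette 4) *
          ∫ U, fderiv ℝ g (fun q a => plaqField r β U (q : ZdPlaquette 4) a)
            (fun q a => if q = p ∧ a = b then (1 : ℝ) else 0) ∂μ) -
        ∫ U, g (fun q a => plaqField r β U (q : ZdPlaquette 4) a) *
          (∑ p ∈ S, plaquetteCurl (fun e' => if e' = e then (1 : ℝ) else 0) p * plaqField r β U p b) ∂μ| ≤
      M * (θ / 2 + K * (∫ U, ∑ p ∈ S, ∑ i : Fin 4,
          ((r.N : ℝ) - (r.ρ (axialFix U (plaquetteBoundary p i))).trace.re) ∂μ) / (2 * θ)) +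
        K * Real.sqrt β * ∫ U, ∑ q ∈ plaquettesTouching ({e} : Finset (Literature.MathematicalPhysics.QuantumLattice.ZdEdge 4)),
          ∑ i : Fin 4, ((r.N : ℝ) - (r.ρ (axialFix U (plaquetteBoundary q i))).trace.re) ∂μ := by
  classical
  have hYc : ∀ (p : ZdPlaquette 4) (a : Fin (lieDim r)), Continuous fun U : LGConfig 4 G => plaqField r β U p a :=
    fun p a => TangentPlaqFieldContinuous.continuous_plaqField_apply r β p a
  have hWc : ∀ p : ZdPlaquette 4, Continuous fun U : LGConfig 4 G =>
      ∑ i : Fin 4, ((r.N : ℝ) - (r.ρ (axialFix U (plaquetteBoundary p i))).trace.re) := fun p =>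
    continuous_finsetSum _ fun i _ => continuous_const.sub
      (Complex.continuous_re.comp ((r.continuous.comp (TangentPlaqFieldContinuous.continuous_axialFix _)).matrix_trace))
  have hW0 : ∀ (U : LGConfig 4 G) (p : ZdPlaquette 4),
      0 ≤ ∑ i : Fin 4, ((r.N : ℝ) - (r.ρ (axialFix U (plaquetteBoundary p i))).trace.re) := fun U p =>
    Finset.sum_nonneg fun i _ => sub_nonneg.2 (TangentCombPoincare.re_trace_le r.ρ r.mem_unitary _)
  have hSec : Continuous (wilsonBoundaryAction (G := G) r.ρ {e}) :=
    (TangentHaarShiftLimit.continuous_bounded_boundaryAction (G := G) r.ρ r.continuous {e}).1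
  have hδ0 : ∀ p ∈ S, p ∉ plaquettesTouching ({e} : Finset (Literature.MathematicalPhysics.QuantumLattice.ZdEdge 4)) →
      plaquetteCurl (fun e' => if e' = e then (1 : ℝ) else 0) p = 0 := fun p _ hp => curl_indicator_eq_zero hp
  -- the Haar identity for the block test observable
  obtain ⟨SF, hcyl, hFc, hFb⟩ := cylinder_block (G := G) r β S g hg.continuous hgb
  have hH := hHaar _ SF hcyl hFc ⟨1, hFb⟩
  exact core_defect_fderiv μ hβ S _ hS b (fun p => plaquetteCurl (fun e' => if e' = e then (1 : ℝ) else 0) p) hδ0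
    (by norm_num : (0 : ℝ) ≤ 4) (fun p => abs_curl_indicator_le e p) σ hσ T hT0 hflow hTc (plaqField r β) hYc
    (fun U p => ∑ i : Fin 4, ((r.N : ℝ) - (r.ρ (axialFix U (plaquetteBoundary p i))).trace.re)) hWc hW0
    (wilsonBoundaryAction r.ρ {e}) hSec
    (fun U => ∑ p ∈ S, plaquetteCurl (fun e' => if e' = e then (1 : ℝ) else 0) p * plaqField r β U p b) (fun U => rfl)
    K hK hY hD g hM hg hgb hgM hH hθ

/-- **The `C¹` block defect for a given link `e`**: choose the left family (non-comb link, or forward comb link) or the right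
family (backward comb link), feed STUB TS0 (`stub_combShift`, flow property), the derivative statements of STUBS TS3/TS4
(hypotheses `h3`, `h4`) and STUB TS2 (`stub_haarShiftLimit`) into `defect_fderiv_pair`. -/
theorem defect_fderiv_le [T2Space G] (r : LatticeRep G) (b : Fin (lieDim r)) {k : ℝ → G}
    (hk : ∀ t : ℝ, r.ρ (k t) = NormedSpace.exp ((t : ℂ) • lieVec r b))
    {K₃ K₄ K : ℝ} (hK0 : 0 ≤ K) (hK3 : K₃ ≤ K) (hK4 : K₄ ≤ K)
    (h3 : ∀ (β : ℝ) (U : LGConfig 4 G) (e : Literature.MathematicalPhysics.QuantumLattice.ZdEdge 4)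
      (p : ZdPlaquette 4) (a : Fin (lieDim r)),
      (((¬ ∀ j : Fin 4, e.2 < j → e.1 j = 0) ∨ 0 ≤ e.1 e.2) → ∃ err : ℝ,
        HasDerivAt (fun t : ℝ => plaqField r β (Function.update U e
            ((combTransport U e.1)⁻¹ * k t * combTransport U e.1 * U e)) p a)
          (Real.sqrt β * ((if a = b then plaquetteCurl (fun e' => if e' = e then (1 : ℝ) else 0) p else 0) + err)) 0 ∧
        err ^ 2 ≤ K₃ * ∑ i : Fin 4, ((r.N : ℝ) - (r.ρ (axialFix U (plaquetteBoundary p i))).trace.re)) ∧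
      ((∀ j : Fin 4, e.2 < j → e.1 j = 0) → e.1 e.2 < 0 → ∃ err : ℝ,
        HasDerivAt (fun t : ℝ => plaqField r β (Function.update U e
            (U e * ((combTransport U (e.1 + Pi.single e.2 1))⁻¹ * (k t)⁻¹ *
              combTransport U (e.1 + Pi.single e.2 1)))) p a)
          (Real.sqrt β * (-(if a = b then plaquetteCurl (fun e' => if e' = e then (1 : ℝ) else 0) p else 0) + err)) 0 ∧
        err ^ 2 ≤ K₃ * ∑ i : Fin 4, ((r.N : ℝ) - (r.ρ (axialFix U (plaquetteBoundary p i))).trace.re)))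
    (h4 : ∀ (β : ℝ) (U : LGConfig 4 G) (e : Literature.MathematicalPhysics.QuantumLattice.ZdEdge 4),
      (((¬ ∀ j : Fin 4, e.2 < j → e.1 j = 0) ∨ 0 ≤ e.1 e.2) → ∃ D : ℝ,
        HasDerivAt (fun t : ℝ => wilsonBoundaryAction r.ρ {e} (Function.update U e
            ((combTransport U e.1)⁻¹ * k t * combTransport U e.1 * U e))) D 0 ∧
        |Real.sqrt β * D - ∑ q ∈ plaquettesTouching {e},
            plaquetteCurl (fun e' => if e' = e then (1 : ℝ) else 0) q * plaqField r β U q b| ≤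
          K₄ * Real.sqrt β * ∑ q ∈ plaquettesTouching {e}, ∑ i : Fin 4,
            ((r.N : ℝ) - (r.ρ (axialFix U (plaquetteBoundary q i))).trace.re)) ∧
      ((∀ j : Fin 4, e.2 < j → e.1 j = 0) → e.1 e.2 < 0 → ∃ D : ℝ,
        HasDerivAt (fun t : ℝ => wilsonBoundaryAction r.ρ {e} (Function.update U e
            (U e * ((combTransport U (e.1 + Pi.single e.2 1))⁻¹ * (k t)⁻¹ *
              combTransport U (e.1 + Pi.single e.2 1))))) D 0 ∧
        |Real.sqrt β * D + ∑ q ∈ plaquettesTouching {e},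
            plaquetteCurl (fun e' => if e' = e then (1 : ℝ) else 0) q * plaqField r β U q b| ≤
          K₄ * Real.sqrt β * ∑ q ∈ plaquettesTouching {e}, ∑ i : Fin 4,
            ((r.N : ℝ) - (r.ρ (axialFix U (plaquetteBoundary q i))).trace.re)))
    {β : ℝ} (hβ : 0 < β) (μ : Measure (LGConfig 4 G)) (hμ : μ ∈ infiniteVolumeLimitPoints (d := 4) r.ρ β)
    (e : Literature.MathematicalPhysics.QuantumLattice.ZdEdge 4) (S : Finset (ZdPlaquette 4))
    (hS : plaquettesTouching ({e} : Finset (Literature.MathematicalPhysics.QuantumLattice.ZdEdge 4)) ⊆ S)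
    (g : (↥S → Fin (lieDim r) → ℝ) → ℝ) {M : ℝ} (hM : 0 ≤ M) (hg : ContDiff ℝ 1 g)
    (hgb : ∀ y, |g y| ≤ 1) (hgM : ∀ y, ‖fderiv ℝ g y‖ ≤ M) {θ : ℝ} (hθ : 0 < θ) :
    |(∑ p : ↥S, plaquetteCurl (fun e' => if e' = e then (1 : ℝ) else 0) (p : ZdPlaquette 4) *
          ∫ U, fderiv ℝ g (fun q a => plaqField r β U (q : ZdPlaquette 4) a)
            (fun q a => if q = p ∧ a = b then (1 : ℝ) else 0) ∂μ) -
        ∫ U, g (fun q a => plaqField r β U (q : ZdPlaquette 4) a) *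
          (∑ p ∈ S, plaquetteCurl (fun e' => if e' = e then (1 : ℝ) else 0) p * plaqField r β U p b) ∂μ| ≤
      M * (θ / 2 + K * (∫ U, ∑ p ∈ S, ∑ i : Fin 4,
          ((r.N : ℝ) - (r.ρ (axialFix U (plaquetteBoundary p i))).trace.re) ∂μ) / (2 * θ)) +
        K * Real.sqrt β * ∫ U, ∑ q ∈ plaquettesTouching ({e} : Finset (Literature.MathematicalPhysics.QuantumLattice.ZdEdge 4)),
          ∑ i : Fin 4, ((r.N : ℝ) - (r.ρ (axialFix U (plaquetteBoundary q i))).trace.re) ∂μ := by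
  haveI : IsProbabilityMeasure μ := by
    obtain ⟨L, -, hP, -⟩ := hμ
    exact hP
  have hW0 : ∀ (U : LGConfig 4 G) (p : ZdPlaquette 4),
      0 ≤ ∑ i : Fin 4, ((r.N : ℝ) - (r.ρ (axialFix U (plaquetteBoundary p i))).trace.re) := fun U p =>
    Finset.sum_nonneg fun i _ => sub_nonneg.2 (TangentCombPoincare.re_trace_le r.ρ r.mem_unitary _)
  have hSW0 : ∀ U : LGConfig 4 G, 0 ≤ Real.sqrt β * ∑ q ∈ plaquettesTouching ({e} : Finset (Literature.MathematicalPhysics.QuantumLattice.ZdEdge 4)),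
      ∑ i : Fin 4, ((r.N : ℝ) - (r.ρ (axialFix U (plaquetteBoundary q i))).trace.re) := fun U =>
    mul_nonneg (Real.sqrt_nonneg _) (Finset.sum_nonneg fun q _ => hW0 U q)
  by_cases hc : (¬ ∀ j : Fin 4, e.2 < j → e.1 j = 0) ∨ 0 ≤ e.1 e.2
  · -- the left family, `σ = 1`
    have hinv : ∀ (U : LGConfig 4 G) (g : G), combTransport (Function.update U e g) e.1 = combTransport U e.1 := by
      intro U g
      rcases hc with hnc | hnn
      · exact CombBasics.combTransport_update_of_not_isComb U hnc g e.1
      · exact (stub_combShift G U e g).2.2.1 hnn g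
    obtain ⟨T, hTdef, hT0, hflow, hTc, hinvT⟩ := leftFamily hk e hinv
    refine defect_fderiv_pair r hβ μ e b S hS 1 (Or.inl rfl) T hT0 hflow hTc K hK0 (fun U p a => ?_) (fun U => ?_)
      (fun F SF hF hFc hFb t => ?_) g hM hg hgb hgM hθ
    · obtain ⟨err, hd, he⟩ := (h3 β U e p a).1 hc
      refine ⟨err, ?_, he.trans (mul_le_mul_of_nonneg_right hK3 (hW0 U p))⟩
      simp only [hTdef, one_mul]
      exact hd
    · obtain ⟨D, hd, hbd⟩ := (h4 β U e).1 hc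
      refine ⟨D, ?_, ?_⟩
      · simp only [hTdef]
        exact hd
      rw [one_mul]
      refine hbd.trans ?_
      rw [mul_assoc, mul_assoc]
      exact mul_le_mul_of_nonneg_right hK4 (hSW0 U)
    · obtain ⟨Sγ, hγ, hγc⟩ := cylinder_conj (G := G) e.1 (k t)
      have hid := (stub_haarShiftLimit G r.ρ r.continuous β μ hμ e
        (fun U => (combTransport U e.1)⁻¹ * k t * combTransport U e.1) Sγ hγ hγc
        (fun U g => by simp only [hinv]) F SF hF hFc hFb).1
      simp only [hinvT] at hid
      have hT' : ∀ U : LGConfig 4 G, F (T t U) =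
          F (Function.update U e ((combTransport U e.1)⁻¹ * k t * combTransport U e.1 * U e)) := fun U => by rw [hTdef]
      simp only [hT']
      exact hid
  · -- the right family, `σ = -1`
    push Not at hc
    obtain ⟨hcomb, hneg⟩ := hc
    have hinv : ∀ (U : LGConfig 4 G) (g : G), combTransport (Function.update U e g) (e.1 + Pi.single e.2 1) =
        combTransport U (e.1 + Pi.single e.2 1) := fun U g => (stub_combShift G U e g).2.2.2 hneg g
    obtain ⟨T, hTdef, hT0, hflow, hTc, hinvT⟩ := rightFamily hk e hinv
    refine defect_fderiv_pair r hβ μ e b S hS (-1) (Or.inr rfl) T hT0 hflow hTc K hK0 (fun U p a => ?_) (fun U => ?_)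
      (fun F SF hF hFc hFb t => ?_) g hM hg hgb hgM hθ
    · obtain ⟨err, hd, he⟩ := (h3 β U e p a).2 hcomb hneg
      refine ⟨err, ?_, he.trans (mul_le_mul_of_nonneg_right hK3 (hW0 U p))⟩
      simp only [hTdef, neg_one_mul]
      exact hd
    · obtain ⟨D, hd, hbd⟩ := (h4 β U e).2 hcomb hneg
      refine ⟨D, ?_, ?_⟩
      · simp only [hTdef]
        exact hd
      rw [neg_one_mul, sub_neg_eq_add]
      refine hbd.trans ?_
      rw [mul_assoc, mul_assoc]
      exact mul_le_mul_of_nonneg_right hK4 (hSW0 U)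
    · obtain ⟨Sγ, hγ, hγc⟩ := cylinder_conj (G := G) (e.1 + Pi.single e.2 1) (k t)⁻¹
      have hid := (stub_haarShiftLimit G r.ρ r.continuous β μ hμ e
        (fun U => (combTransport U (e.1 + Pi.single e.2 1))⁻¹ * (k t)⁻¹ * combTransport U (e.1 + Pi.single e.2 1))
        Sγ hγ hγc (fun U g => by simp only [hinv]) F SF hF hFc hFb).2
      simp only [hinvT] at hid
      have hT' : ∀ U : LGConfig 4 G, F (T t U) = F (Function.update U e (U e *
          ((combTransport U (e.1 + Pi.single e.2 1))⁻¹ * (k t)⁻¹ * combTransport U (e.1 + Pi.single e.2 1)))) :=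
        fun U => by rw [hTdef]
      simp only [hT']
      exact hid

/-- **The `C¹` block defect for a given link, with STUBS TS3/TS4 discharged** (`stub_shiftDerivField` with TS0 `stub_combShift`, and
`stub_shiftDerivAction`): there is `K ≥ 0` (depending on `r`, `b` and the one-parameter subgroup `k` only) such that for every `β > 0`,
every torus-limit state `μ` at `β`, every link `e`, every `S ⊇ plaquettesTouching {e}`, every `C¹` block test `g` with `|g| ≤ 1`,
`‖∇g‖ ≤ M` and every `θ > 0`, the single-edge Schwinger–Dyson defect is at most `M(θ/2 + K ∫∑_{S} W dμ/(2θ)) + K√β ∫ ∑_{Pe} W dμ`. -/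
theorem defect_fderiv_le' [T2Space G] (r : LatticeRep G) (b : Fin (lieDim r)) {k : ℝ → G}
    (hk : ∀ t : ℝ, r.ρ (k t) = NormedSpace.exp ((t : ℂ) • lieVec r b)) :
    ∃ K : ℝ, 0 ≤ K ∧ ∀ {β : ℝ}, 0 < β → ∀ (μ : Measure (LGConfig 4 G)), μ ∈ infiniteVolumeLimitPoints (d := 4) r.ρ β →
      ∀ (e : Literature.MathematicalPhysics.QuantumLattice.ZdEdge 4) (S : Finset (ZdPlaquette 4)),
        plaquettesTouching ({e} : Finset (Literature.MathematicalPhysics.QuantumLattice.ZdEdge 4)) ⊆ S →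
        ∀ (g : (↥S → Fin (lieDim r) → ℝ) → ℝ) {M : ℝ}, 0 ≤ M → ContDiff ℝ 1 g →
          (∀ y, |g y| ≤ 1) → (∀ y, ‖fderiv ℝ g y‖ ≤ M) → ∀ {θ : ℝ}, 0 < θ →
    |(∑ p : ↥S, plaquetteCurl (fun e' => if e' = e then (1 : ℝ) else 0) (p : ZdPlaquette 4) *
          ∫ U, fderiv ℝ g (fun q a => plaqField r β U (q : ZdPlaquette 4) a)
            (fun q a => if q = p ∧ a = b then (1 : ℝ) else 0) ∂μ) -
        ∫ U, g (fun q a => plaqField r β U (q : ZdPlaquette 4) a) *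
          (∑ p ∈ S, plaquetteCurl (fun e' => if e' = e then (1 : ℝ) else 0) p * plaqField r β U p b) ∂μ| ≤
      M * (θ / 2 + K * (∫ U, ∑ p ∈ S, ∑ i : Fin 4,
          ((r.N : ℝ) - (r.ρ (axialFix U (plaquetteBoundary p i))).trace.re) ∂μ) / (2 * θ)) +
        K * Real.sqrt β * ∫ U, ∑ q ∈ plaquettesTouching ({e} : Finset (Literature.MathematicalPhysics.QuantumLattice.ZdEdge 4)),
          ∑ i : Fin 4, ((r.N : ℝ) - (r.ρ (axialFix U (plaquetteBoundary q i))).trace.re) ∂μ := by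
  obtain ⟨K₃, h3⟩ := stub_shiftDerivField G r b k hk (stub_combShift G)
  obtain ⟨K₄, h4⟩ := stub_shiftDerivAction G r b k hk
  refine ⟨max (max K₃ K₄) 0, le_max_right _ _, ?_⟩
  intro β hβ μ hμ e S hS g M hM hg hgb hgM θ hθ
  exact defect_fderiv_le r b hk (le_max_right _ _) ((le_max_left _ _).trans (le_max_left _ _))
    ((le_max_right _ _).trans (le_max_left _ _)) h3 h4 hβ μ hμ e S hS g hM hg hgb hgM hθ

end Pair

end SdRate

end Summit.QuantumFields.YangMills.Cruxes.FreeProbeLawG.SteinFree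

end
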